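import Summits.PneNP.PneNP.Theses.ArnoldMorseDeficit
import Literature.Computability.Complexity.SearchToDecision
import Literature.Computability.Complexity.TFNPProblems
import Literature.Computability.Complexity.ClayProblem
import Literature.Computability.Complexity.ClayProblemProofs

/-!
# Route ArnoldMorseDeficit — `Assembly` (stmt-PneNP-11732)

`Assembly := MorseDeficitTotal → MorseDeficitCheckP → MorseDeficitHard → PneNP`: the TFNP pattern. If Cook's `PneNP`
failed then `NP ⊆ P` (proved model bridges), and since the solution-checking language is in `P` (`MorseDeficitCheckP`),
search reduces to decision (`exists_searchFn_of_NP_subset_P`, witness bound `|x|²`): some `g ∈ FP` returns, on the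
code of every valid instance, the cell bits of a solution (one exists by `MorseDeficitTotal`, of length
`n·m + n ≤ |code|²`; the instance code is injective), contradicting `MorseDeficitHard`.
-/

set_option linter.dupNamespace false -- `Summit.PneNP.PneNP.…`: summit = sub-problem name (D-0017 single-conjunct layout)

namespace Summit.PneNP.PneNP.Theorems

open Polynomial
open Literature.Computability.Complexity Computability

/-- **Assembly item of route ArnoldMorseDeficit (stmt-PneNP-11732)**:
`MorseDeficitTotal → MorseDeficitCheckP → MorseDeficitHard → PneNP` — under `¬PneNP`, search-to-decision for the `P`-checkable,
total solution relation gives an `FP` solver, contradicting hardness. [cite: AroraBarakCC2009, Thm. 2.18] [folklore] -/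
theorem arnoldMorseDeficit_assembly_proof : Summit.PneNP.PneNP.Theses.ArnoldMorseDeficit.Assembly := by
  unfold Summit.PneNP.PneNP.Theses.ArnoldMorseDeficit.Assembly Summit.PneNP.PneNP.Theses.ArnoldMorseDeficit.MorseDeficitTotal
    Summit.PneNP.PneNP.Theses.ArnoldMorseDeficit.MorseDeficitCheckP Summit.PneNP.PneNP.Theses.ArnoldMorseDeficit.MorseDeficitHard
  intro hT hC hH
  dsimp only at hT hC hH
  by_contra hcon
  have hP : PNPWave0.P Bool = Classes.P := P_bool_eq_holds
  have hN : PNPWave0.NP Bool = Nondeterministic.NP := NP_bool_eq_holds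
  have hsub : Nondeterministic.NP ⊆ Classes.P := by
    intro L hL
    by_contra hLP
    exact hcon ⟨L, hN ▸ hL, hP ▸ hLP⟩
  apply hH
  obtain ⟨g, hg, hspec⟩ := exists_searchFn_of_NP_subset_P hsub hC (X ^ 2)
  refine ⟨g, hg, ?_⟩
  rintro ⟨n, m, D, T⟩ hI
  obtain ⟨c, hc⟩ := hT (n, m, D, T) hI
  have hres := hspec _ ⟨_, ?_, (n, m, D, T), c, rfl, hI, hc⟩
  · obtain ⟨-, hmem⟩ := hres
    obtain ⟨⟨n', m', D', T'⟩, c', hz, hV', hS'⟩ := hmem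
    have h1 := congrArg boolUnpair hz
    simp only [boolUnpair_boolPair, Prod.mk.injEq] at h1
    obtain ⟨hI', hg'⟩ := h1
    have h2 := congrArg boolUnpair hI'
    simp only [boolUnpair_boolPair, Prod.mk.injEq] at h2
    obtain ⟨hn, h3⟩ := h2
    have h4 := congrArg boolUnpair h3
    simp only [boolUnpair_boolPair, Prod.mk.injEq] at h4
    obtain ⟨hm, h5⟩ := h4
    have h6 := congrArg boolUnpair h5
    simp only [boolUnpair_boolPair, Prod.mk.injEq] at h6
    obtain ⟨hD, hTT⟩ := h6
    obtain rfl : n = n' := by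
      rw [← unary_decode_encode_nat n, ← unary_decode_encode_nat n', hn]
    obtain rfl : m = m' := by
      rw [← unary_decode_encode_nat m, ← unary_decode_encode_nat m', hm]
    obtain rfl : D = D' := TFNP.encList_injective hD
    obtain rfl : T = T' := TFNP.encList_injective hTT
    exact ⟨c', hg'.symm, hS'⟩
  · -- the witness length bound `n·m + n ≤ |code|²`
    simp only [List.length_append, List.length_flatten, List.map_ofFn, List.sum_ofFn, Function.comp,
      List.length_ofFn, Finset.sum_const, Finset.card_univ, Fintype.card_fin, smul_eq_mul, eval_pow, eval_X,
      length_boolPair]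
    have hln : (unaryEncodeNat n).length = n := unary_decode_encode_nat n
    have hlm : (unaryEncodeNat m).length = m := unary_decode_encode_nat m
    rw [hln, hlm]
    nlinarith [Nat.zero_le n, Nat.zero_le m, Nat.zero_le ((encList D).length), Nat.zero_le ((encList T).length)]

end Summit.PneNP.PneNP.Theorems
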